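import Literature.AnabelianGeometry.EtaleTheta.TemperedFrobenioidToyTorsionGenuineUnits
import Literature.AnabelianGeometry.EtaleTheta.Discharge.Sec3RatFnMonoidOn
import Literature.AlgebraicGeometry.Frobenioids.ArithmeticFrobenioidUnitProfinite

/-!
# [EtTh] Thm. 3.7 (i)/(iv) at the torsion tempered Frobenioid: a Frobenioid of UNIT-PROFINITE, NOT unit-trivial, type with
# `O^×(A) ↪ (ℤ/2)²` for every object — non-vacuity of the `Λ = ℤ` clause (proof-only)

S. Mochizuki, *The étale theta function …*, Publ. RIMS **45** (2009) [MochizukiEtTh2009], Thm. 3.7 (i) p. 305 (PDF p. 79) ("`C` is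
… of unit-profinite type [if `Λ = ℤ`]"), Thm. 3.7 (iv) p. 306 (PDF p. 80), Prop. 3.4 (ii) p. 300 (PDF p. 74) ("`O_L^× = Ker(B₀ → Φ₀^gp)`");
[FrdI] Def. 2.8 (i) p. 52 (unit-profinite type), Thm. 5.2 (i)/(ii) p. 100–101 [MochizukiFrdI2008].
abc-iut cell, layer L2; seat abc-iut-f-125 (gen 3), self-named row «TORSION-TF» part 3 (sequel of R228-NEXT, abc-iut-L2-lead gen 4).
PROOF-ONLY (theorems only; nothing landed is edited or restated): the torsion tempered Frobenioid `C := ToyTorsion.genuineTemperedFrobenioid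
R S` (p446075; Def. 3.6 (ii) over the genuine vocabularies, base `SingleObj ℤ`, `B₀^Λ = ℤ × (ℤ/2)²`) is run through the tree's
[EtTh] Thm. 3.7 machinery (abc-iut-w5-d250 / w5-d164 / L6-t12 lineages, consumed BY NAME):
* `isFrobenioid_genuineTemperedFrobenioid` — `C` IS a Frobenioid ([FrdI] Thm. 5.2 (ii) via `isFrobenioid_treeCatVocab_of_isMonoidOn`;
  `B` is a monoid on `SingleObj ℤ`: its pull-backs are the invertible swap actions, and every arrow of the groupoid base is invertible);
* `fst_unit_eq_one`, `units_to_V_injective`, `finite_units` — for EVERY object `A = (⋆, α)`: a unit's rational function is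
  `((0, v), 0)` (`Div_B(u) = 0`, [FrdI] Thm. 5.2 (ii); the `ℤ`-coordinate dies because `B₀^Λ → (Φ₀^ℝ)^gp` is injective on it —
  Prop. 3.4 (ii)'s "`O_L^× = Ker`"), so `u ↦ v` embeds `O^×(A)` into `(ℤ/2)²`: `O^×(A)` is FINITE (and non-trivial at `(⋆, 0)`,
  `ToyTorsion.not_isUnitTrivial`, p446819);
* **`isOfUnitProfiniteType_genuineTemperedFrobenioid`** — `C` is of UNIT-PROFINITE type ([FrdI] Def. 2.8 (i): a finite group with the
  discrete topology, abc-iut-L6-t10's `AdmitsTfgProfiniteTopology.of_finite`) — the FIRST CONSTRUCTED tempered Frobenioid at `Λ = ℤ`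
  witnessing Thm. 3.7 (i)'s unit-profinite clause NON-DEGENERATELY (all earlier witnesses are unit-trivial);
* **`thm37_iv_genuineTemperedFrobenioid`** — abc-iut-L2-t3's named `Prop` `Thm37_iv` (F-0744) HOLDS at `C`
  (`thm37_iv_of_isOfUnitProfiniteType`: no divisible units in a finite group).
HONEST LABEL: degenerate geometry (one base object, `Aut(⋆) = ℤ`, `Φ₀ = ℕ`, constants `ℤ × (ℤ/2)²`); consistency / instance-form
evidence for the typed interfaces, NOT the tempered Frobenioid of a curve; nothing here bears on [IUTchIII] Cor. 3.12; typed ≠ proved.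
-/

noncomputable section

namespace Literature.AnabelianGeometry.EtaleTheta

open CategoryTheory Opposite Literature.AlgebraicGeometry.Frobenioids

namespace ToyTorsion

variable (R S : (Baseᵒᵖ ⥤ CommMonCat.{0}) → Prop)

/-! ### `C` is a Frobenioid -/

/-- Pull-backs of `B₀^Λ = B₀` along the arrows of `SingleObj ℤ` are injective (they are the swap automorphisms `swapE^n`).
[cite: MochizukiEtTh2009, Def 3.3 p.299 (PDF p.73)] -/
theorem realifiedGenuine_BΛ_map_injective {Y Y' : Baseᵒᵖ} (g : Y ⟶ Y') : Function.Injective (realifiedGenuine.BΛ.map g).hom :=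
  fun _ _ h => (act g.unop).injective h

/-- **`B` is a monoid on `SingleObj ℤ`** ([FrdI] Def. 1.1 (ii); abc-iut-L6-t12-lineage `isMonoidOn_ratFnFunctor`: `B₀^Λ` pull-backs injective,
every (FSM-)arrow of the groupoid base invertible).  [cite: MochizukiFrdI2008, Def. 1.1 (ii) p.19] -/
theorem isMonoidOn_ratFnFunctor_genuineTemperedFrobenioid : IsMonoidOn (Literature.AnabelianGeometry.EtaleTheta.ToyTorsion.genuineTemperedFrobenioid R S).ratFnFunctor :=
  (Literature.AnabelianGeometry.EtaleTheta.ToyTorsion.genuineTemperedFrobenioid R S).isMonoidOn_ratFnFunctor (fun g => realifiedGenuine_BΛ_map_injective g) fun _ _ => inferInstance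

/-- **The torsion tempered Frobenioid IS a Frobenioid** ([FrdI] Thm. 5.2 (ii) at the canonical vocabularies,
`isFrobenioid_treeCatVocab_of_isMonoidOn`).  [cite: MochizukiFrdI2008, Thm. 5.2 (ii) p.101] -/
theorem isFrobenioid_genuineTemperedFrobenioid : PreFrobenioid.IsFrobenioid (Literature.AnabelianGeometry.EtaleTheta.ToyTorsion.genuineTemperedFrobenioid R S).toElem :=
  (Literature.AnabelianGeometry.EtaleTheta.ToyTorsion.genuineTemperedFrobenioid R S).isFrobenioid_treeCatVocab_of_isMonoidOn (isMonoidOn_ratFnFunctor_genuineTemperedFrobenioid R S)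

/-! ### The units of EVERY object embed into `(ℤ/2)²` -/

/-- `B₀^Λ(Y) → (Φ₀^ℝ)^gp(Y)` kills exactly the `(ℤ/2)²`-part: if `div^Λ(b) = 0` then the `ℤ`-coordinate of `b` is `0` (`𝔭^k ↦ ι(𝔭)^k` is
injective — abc-iut-w5-d164's `Toy.realifiedGenuine_divΛ_injective`).  [cite: MochizukiEtTh2009, Prop 3.4 p.300 (PDF p.74)] -/
theorem fst_eq_one_of_divΛ_eq_one (Y : Baseᵒᵖ) (b : M) (h : realifiedGenuine.divΛ Y b = 1) : b.1 = 1 := by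
  have h' : Toy.realifiedGenuine.divΛ (op ⟨PUnit.unit⟩) b.1 = Toy.realifiedGenuine.divΛ (op ⟨PUnit.unit⟩) 1 := by
    rw [map_one]
    exact h
  exact Toy.realifiedGenuine_divΛ_injective _ h'

variable (A : (Literature.AnabelianGeometry.EtaleTheta.ToyTorsion.genuineTemperedFrobenioid R S).category)

/-- **The `ℤ`-coordinate of a unit's rational function is `0`** (`u_σ = ((0, v), 0)`): `Div_B(u_σ) = 0` ([FrdI] Thm. 5.2 (ii)) and the
fibre-product condition put `u_σ`'s `B₀^Λ`-part in `Ker(B₀^Λ → (Φ₀^ℝ)^gp)` (abc-iut-w5-d250-lineage `fst_unitsToRatFn_mem_ker`).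
[cite: MochizukiEtTh2009, Prop 3.4 p.300 (PDF p.74)] -/
theorem fst_unit_eq_one (a : ModelFrobenioid.units A) : ((ModelFrobenioid.unit a.1.hom).1.1).1 = 1 :=
  fst_eq_one_of_divΛ_eq_one _ _
    ((Literature.AnabelianGeometry.EtaleTheta.ToyTorsion.genuineTemperedFrobenioid R S).fst_unitsToRatFn_mem_ker (isFrobenioid_genuineTemperedFrobenioid R S) A a)

/-- The `Φ^gp`-coordinate of a unit's rational function is `0` (`Div_B(u_σ) = Div(σ) = 0`, `Φ(A)` sharp).
[cite: MochizukiFrdI2008, Thm. 5.2 (ii) p.101] -/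
theorem snd_unit_eq_one (a : ModelFrobenioid.units A) : (ModelFrobenioid.unit a.1.hom).1.2 = 1 :=
  ModelFrobenioid.divB_unitsToRatFn_eq_one
    ((isFrobenioid_genuineTemperedFrobenioid R S).isPreFrobenioid.isDivisorial A.base).isSharp a

/-- **`O^×(A) → (ℤ/2)²`, `σ ↦ v` (the `(ℤ/2)²`-coordinate of `u_σ`) is injective** for every object `A`: a unit is determined by its
rational function ([FrdI] Thm. 5.2 (ii), abc-iut-L1's `unitsToRatFn_injective`), which is `((0, v), 0)`.
[cite: MochizukiFrdI2008, Thm. 5.2 (ii) p.101] -/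
theorem units_to_V_injective :
    Function.Injective fun a : ModelFrobenioid.units A => ((ModelFrobenioid.unit a.1.hom).1.1).2 := by
  intro a b hab
  apply ModelFrobenioid.unitsToRatFn_injective
    ((isFrobenioid_genuineTemperedFrobenioid R S).isPreFrobenioid.isDivisorial A.base).isPreDivisorial.isIntegral
  apply Units.ext
  rw [ModelFrobenioid.coe_unitsToRatFn, ModelFrobenioid.coe_unitsToRatFn]
  refine Subtype.ext (Prod.ext (Prod.ext ?_ hab) ?_)
  · rw [fst_unit_eq_one, fst_unit_eq_one]
  · rw [snd_unit_eq_one, snd_unit_eq_one]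

/-- **`O^×(A)` is FINITE for every object** (of order `≤ 4`). [cite: MochizukiEtTh2009, Thm 3.7 p.305 (PDF p.79)] -/
theorem finite_units : Finite (ModelFrobenioid.units A) := Finite.of_injective _ (units_to_V_injective R S A)

/-- The same for `O^×(A)` of the structure functor `C → F_Φ` (same subgroup, abc-iut-w5-d250's `unitsSubgroup_toElem_eq_units`).
[cite: MochizukiEtTh2009, Thm 3.7 p.305 (PDF p.79)] -/
theorem finite_unitsSubgroup : Finite (PreFrobenioid.unitsSubgroup (Literature.AnabelianGeometry.EtaleTheta.ToyTorsion.genuineTemperedFrobenioid R S).toElem A) :=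
  haveI := finite_units R S A
  Finite.of_equiv _ (MulEquiv.subgroupCongr ((Literature.AnabelianGeometry.EtaleTheta.ToyTorsion.genuineTemperedFrobenioid R S).unitsSubgroup_toElem_eq_units A)).symm.toEquiv

/-! ### Thm. 3.7 (i) `Λ = ℤ` clause and Thm. 3.7 (iv) at the torsion tempered Frobenioid -/

/-- **The torsion tempered Frobenioid is of UNIT-PROFINITE type** ([FrdI] Def. 2.8 (i); [EtTh] Thm. 3.7 (i), `Λ = ℤ`): every `O^×(A)` is
finite, hence a topologically finitely generated profinite group for the discrete topology (abc-iut-L6-t10's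
`AdmitsTfgProfiniteTopology.of_finite`) — and NOT trivial (`ToyTorsion.not_isUnitTrivial`).  [cite: MochizukiEtTh2009, Thm 3.7 p.305 (PDF p.79)] -/
theorem isOfUnitProfiniteType_genuineTemperedFrobenioid :
    PreFrobenioid.IsOfUnitProfiniteType (Literature.AnabelianGeometry.EtaleTheta.ToyTorsion.genuineTemperedFrobenioid R S).toElem := fun A =>
  haveI := finite_unitsSubgroup R S A
  AdmitsTfgProfiniteTopology.of_finite _

/-- **Thm. 3.7 (i)'s unit-profinite clause has a NON-DEGENERATE constructed witness**: a tempered Frobenioid of unit-profinite but NOT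
unit-trivial type.  [cite: MochizukiEtTh2009, Thm 3.7 p.305 (PDF p.79)] -/
theorem isOfUnitProfiniteType_and_not_isUnitTrivial :
    PreFrobenioid.IsOfUnitProfiniteType (Literature.AnabelianGeometry.EtaleTheta.ToyTorsion.genuineTemperedFrobenioid R S).toElem ∧
      ¬ PreFrobenioid.IsOfType (PreFrobenioid.IsUnitTrivial (Literature.AnabelianGeometry.EtaleTheta.ToyTorsion.genuineTemperedFrobenioid R S).toElem) :=
  ⟨isOfUnitProfiniteType_genuineTemperedFrobenioid R S, not_isUnitTrivial R S⟩

/-- **[EtTh] Thm. 3.7 (iv) (abc-iut-L2-t3's named `Prop` `Thm37_iv`, FACT-LIST F-0744) HOLDS at the torsion tempered Frobenioid**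
(abc-iut-w5-d250-lineage `thm37_iv_of_isOfUnitProfiniteType`: a finite group has no non-trivial divisible element).
[cite: MochizukiEtTh2009, Thm 3.7 p.306 (PDF p.80)] -/
theorem thm37_iv_genuineTemperedFrobenioid : (Literature.AnabelianGeometry.EtaleTheta.ToyTorsion.genuineTemperedFrobenioid R S).Thm37_iv :=
  (Literature.AnabelianGeometry.EtaleTheta.ToyTorsion.genuineTemperedFrobenioid R S).thm37_iv_of_isOfUnitProfiniteType (isFrobenioid_genuineTemperedFrobenioid R S)
    (isOfUnitProfiniteType_genuineTemperedFrobenioid R S)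

end ToyTorsion

end Literature.AnabelianGeometry.EtaleTheta

end
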